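import Literature.AnabelianGeometry.SemiGraphs.TemperedCosetTowerNoFixedBranchPair
import Literature.AnabelianGeometry.SemiGraphs.ArithEdgeLikeTwoHosts
import Literature.AnabelianGeometry.SemiGraphs.TemperedPiLevelCosetIso
import Literature.AnabelianGeometry.SemiGraphs.TemperedMaximalCompact
import Literature.AnabelianGeometry.SemiGraphs.ArithTemperedGroupOfOuterAction
import Literature.AnabelianGeometry.SemiGraphs.TemperedCosetTowerNoFixedBranchPairOfTower
import Literature.AnabelianGeometry.SemiGraphs.TemperedPiFibreFaithful
import HarnessLib

/-!
# [SemiAnbd] Thm 5.4 (i) p. 66, producer T54-B: the GEOMETRIC faithfulness binder `hfaith` of the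
# (AI4″) branch-pair producer, at the canonical coset tower (row «T54·hfaith-geom»; proof-only)

Mochizuki, *Semi-graphs of anabelioids*, Publ. RIMS **42** (2006), §5, proof of Thm. 5.4 (i), manuscript
p. 66 ("the proofs are entirely parallel to those of Theorem 3.7, Corollary 3.9": a compact subgroup of
`Π^temp_𝔊` is read through its action on the finite level semi-graphs of the Galois tower), §3 proof of
Thm. 3.7 (iii) p. 41 ("since `𝒢` is totally estranged, `H` fixes precisely one branch")
[cite: MochizukiSemiAnbd2006, Thm 5.4 (i) p.66].

PROOF-ONLY (cell abc-iut, layer L3, sub-DAG `plan/L3/SUBDAG-SemiAnbd-Thm54.md`, producer row T54-B,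
sub-row «T54·hfaith-geom», L3-lead ruling α36 (1a), seat abc-iut-w6-d072; no definition, no new named fact).
abc-iut-w4-d059's (AI4″) producer `map_aug_le_conj_of_levelDict` (the capstone binder `stabBranchPairAug` of
abc-iut-w4-d029's `ArithThm54iCapstoneOuterAction`) carries, besides the arithmetic cofinality `hcof`
(⟺ `hfaith_A`, abc-iut-w4-d085's `hcof_of_faithful_levels`), the GEOMETRIC faithfulness binder

  `hfaith : ∀ v ∈ D.vertGp v₀, (∀ j, levelAct j v = 1) → aug v = 1 → v = 1`

("an element of the arithmetic decomposition group `Π^temp_{𝔊,v₀}` which is geometric (`aug v = 1`) and acts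
trivially on EVERY finite level semi-graph is trivial"; abc-iut-w4-d085 2026-08-26T07:14:21Z, reading (β)).
This file DISCHARGES that binder at the canonical coset tower of the Galois tower of [SemiAnbd] Prop. 3.6
(`𝒢.galoisLevelData h36`, chart `𝒢.temperedPiChart h36`, presentation `piPresentation T R`, finite levels
`ker π_n`, arithmetic actions `arithAct hP (ker π_n) _`, decomposition data `decompositionDataOfChart Rc ι` of
abc-iut-L3-t3/w4-d059) for ANY arithmetic group `E ⊇ ι(π₁^temp(𝒢))` acting compatibly (`hP`, `hN`, `hιΦ`,
`hισ` — the same currency as abc-iut-w4-d083's `hnobpNCpt_cosetTower`) with `ker aug = ι(π₁^temp(𝒢))`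
(exactness of `1 → Π^temp_𝒢 → Π^temp_𝔊 → Π_A → 1`, Prop. 5.2 (iv); at the outer model this is
abc-iut-L3-d2's `outerAction_exact`), FROM the estrangement consequence `hnobpNCpt` (the capstone's binder text:
«no compact `C ≠ 1` of `π₁^temp(𝒢)` fixes, through the arithmetic actions, a compatible system of a vertex
with two distinct abutting branches of the coset semi-graphs» — PRODUCED by abc-iut-w4-d083's
`hnobpNCpt_cosetTower` from (I4′)_cpt, resp. `hnobpNCpt_cosetTower_of_faithV` from (I0v)) and ONE compatible
branch-pair system `(j₀; w, β ≠ β')` (which exists as soon as `𝔾` has an edge; the edgeless one-vertex `𝒢` —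
all level semi-graphs one point — is exactly the counter-shape where `hfaith` fails, abc-iut-w4-d085's
`ArithLevelCofinality` HONEST RESIDUAL).

Route (abc-iut-w4-d085's, by name, no new fact): `aug v = 1` ⇒ `v = ι g` (`ker aug = range ι`);
`ι g ∈ Π^temp_{𝔊,v₀} = C_E(ι Π^temp_{𝔾,v₀})` ⇒ `g ∈ C(Π^temp_{𝔾,v₀}) = Π^temp_{𝔾,v₀}`
(`arithVertGp_inf_range_of_commTerminal` + Thm 3.7 (ii) `commensurator_eq_of_mem_verticialSubgroups`), a
COMPACT subgroup (`isCompact_of_mem_verticialSubgroups`); the subgroup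
`C := Π^temp_{𝔾,v₀} ⊓ ⨅_n ker (arithAct_n ∘ ι)` is compact (each kernel contains the open normal subgroup
`ker π_n` — `arithAct_eq_one_of_inner_mem`, `isOpen_ker_piLevelAut` — hence is open, hence closed) and fixes
every compatible branch-pair system, so `C = ⊥` by `hnobpNCpt`; `g ∈ C`, so `g = 1`, `v = 1`.
NOT the same statement as abc-iut-L3-t11's vertex-fibre faithfulness (I0v) `hfaithV` (faithful action of the
anabelioid vertex group `𝒢_v` on the tower fibres), from which `hnobpNCpt` may be sourced — no circularity.
Nothing here bears on [IUTchIII] Cor. 3.12; typed ≠ proved for the inputs named above.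
-/

namespace Literature.AnabelianGeometry.SemiGraphs

open CategoryTheory Topology

universe u v w

/-! ### Generic core: a compact host, closed level kernels, and the compact-form killing hypothesis -/

section Generic

variable {G : Type u} [Group G] [TopologicalSpace G] [IsTopologicalGroup G]

omit [IsTopologicalGroup G] in
/-- **Generic core of the route.** If `H ≤ G` is compact, the subgroups `N j` are closed, and no compact
subgroup of `G` other than `⊥` lies in every `N j` (the compact-form "no fixed system" hypothesis read on
kernels), then every element of `H` lying in every `N j` is trivial — applied to the compact subgroup
`H ⊓ ⨅ j, N j`. [cite: MochizukiSemiAnbd2006, Thm 3.7 (iii) p.41] -/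
theorem eq_one_of_mem_compact_of_forall_mem_closed {H : Subgroup G} (hHc : IsCompact (H : Set G))
    {J : Type w} (N : J → Subgroup G) (hNc : ∀ j, IsClosed ((N j : Subgroup G) : Set G))
    (hkill : ∀ C : Subgroup G, IsCompact (C : Set G) → (∀ j, C ≤ N j) → C = ⊥)
    {g : G} (hgH : g ∈ H) (hgN : ∀ j, g ∈ N j) : g = 1 := by
  have hcoe : ((H ⊓ ⨅ j, N j : Subgroup G) : Set G) = (H : Set G) ∩ ⋂ j, (N j : Set G) := by
    ext x
    simp only [Subgroup.coe_inf, Subgroup.coe_iInf, Set.mem_inter_iff, Set.mem_iInter, SetLike.mem_coe]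
  have hC : IsCompact ((H ⊓ ⨅ j, N j : Subgroup G) : Set G) := by
    rw [hcoe]
    exact hHc.inter_right (isClosed_iInter hNc)
  have hbot : (H ⊓ ⨅ j, N j : Subgroup G) = ⊥ :=
    hkill _ hC fun j => inf_le_right.trans (iInf_le _ j)
  have hg : g ∈ (H ⊓ ⨅ j, N j : Subgroup G) := ⟨hgH, Subgroup.mem_iInf.mpr hgN⟩
  rw [hbot] at hg
  exact Subgroup.mem_bot.mp hg

/-- A subgroup containing an open subgroup is closed (it is open: a union of cosets of the open one).
[cite: MochizukiSemiAnbd2006, Thm 3.7 (iii) p.41] -/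
theorem Subgroup.isClosed_of_open_le {K N : Subgroup G} (hK : IsOpen (K : Set G)) (hKN : K ≤ N) :
    IsClosed ((N : Subgroup G) : Set G) :=
  Subgroup.isClosed_of_isOpen N (Subgroup.isOpen_mono hKN hK)

end Generic

/-! ### At the canonical coset tower of the Galois tower of Prop. 3.6 -/

namespace ProfiniteSemiGraph

open Literature.AnabelianGeometry.EtaleTheta

variable {𝒢 : ProfiniteSemiGraph.{u}}

/-- **Row «T54·hfaith-geom»: the geometric faithfulness binder `hfaith` of abc-iut-w4-d059's (AI4″) producer
`map_aug_le_conj_of_levelDict`, DISCHARGED at the canonical coset tower** (`𝒢.galoisLevelData h36`, chart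
`𝒢.temperedPiChart h36`, presentation `piPresentation T R`, levels `ker π_n`, arithmetic actions
`arithAct hP (ker π_n) _`, vertex groups of `decompositionDataOfChart Rc ι`) for any arithmetic group
`E ⊇ ι(π₁^temp(𝒢))` acting compatibly with `ker aug = range ι`, from the capstone binder `hnobpNCpt`
(abc-iut-w4-d083's producers) and ONE compatible branch-pair system `(j₀; w, β ≠ β')` of the coset
semi-graphs: an element of `Π^temp_{𝔊,v₀}` which is geometric and acts trivially on every finite coset
semi-graph is trivial. [cite: MochizukiSemiAnbd2006, Thm 5.4 (i) p.66] -/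
theorem hfaith_geom_cosetTower (h36 : 𝒢.Prop36Hypotheses) (h37 : 𝒢.Thm37Hypotheses)
    (hconn : ∀ (n : ℕ) (p q : ((𝒢.galoisLevelData h36).S n).Point),
      ((𝒢.galoisLevelData h36).S n).SameComponent p q)
    (T : ∀ w : 𝒢.graph.Vertex, (𝒢.galoisLevelData h36).PointSeq h36.isCountable w)
    (R : SemiGraph.RefBranches 𝒢.graph) {E : Type v} [Group E]
    {Φ : E →* MulAut (𝒢.temperedPiChart h36).G} {σ : E →* Aut 𝒢.graph}
    (hP : ((𝒢.galoisLevelData h36).piPresentation h36.isCountable T R).IsArithCompatible Φ σ)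
    (hN : ∀ (n : ℕ) (e : E) (x : (𝒢.temperedPiChart h36).G),
      x ∈ ((𝒢.galoisLevelData h36).piLevelAut h36.isCountable hconn n).ker →
        Φ e x ∈ ((𝒢.galoisLevelData h36).piLevelAut h36.isCountable hconn n).ker)
    (ι : (𝒢.temperedPiChart h36).G →* E) (hι : Function.Injective ι)
    (hιΦ : ∀ g, Φ (ι g) = MulAut.conj g) (hισ : ∀ g, σ (ι g) = 1)
    {PA : Type w} [Group PA] (aug : E →* PA) (haug : aug.ker = ι.range)
    (Rc : ChartRepresentatives (𝒢.temperedPiChart h36)) (v₀ : 𝒢.graph.Vertex)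
    (hnobpNCpt : ∀ (C : Subgroup (𝒢.temperedPiChart h36).G),
      IsCompact (C : Set (𝒢.temperedPiChart h36).G) →
      ∀ (j₀ : ℕ) (w : ∀ i : {i : ℕ // j₀ ≤ i},
        (((𝒢.galoisLevelData h36).piPresentation h36.isCountable T R).cosetGraph
          ((𝒢.galoisLevelData h36).piLevelAut h36.isCountable hconn i.1).ker).Vertex)
      (β β' : ∀ i : {i : ℕ // j₀ ≤ i},
        (((𝒢.galoisLevelData h36).piPresentation h36.isCountable T R).cosetGraph
          ((𝒢.galoisLevelData h36).piLevelAut h36.isCountable hconn i.1).ker).Branch),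
      (∀ i, β i ≠ β' i ∧
        (((𝒢.galoisLevelData h36).piPresentation h36.isCountable T R).cosetGraph
          ((𝒢.galoisLevelData h36).piLevelAut h36.isCountable hconn i.1).ker).abuts (β i) = some (w i) ∧
        (((𝒢.galoisLevelData h36).piPresentation h36.isCountable T R).cosetGraph
          ((𝒢.galoisLevelData h36).piLevelAut h36.isCountable hconn i.1).ker).abuts (β' i) = some (w i)) →
      (∀ ⦃i i' : {i : ℕ // j₀ ≤ i}⦄ (h : i.1 ≤ i'.1),
        (((𝒢.galoisLevelData h36).piPresentation h36.isCountable T R).cosetGraphTrans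
            ((𝒢.galoisLevelData h36).ker_piLevelAut_anti h36.isCountable hconn h)).vertexMap (w i') = w i ∧
        (((𝒢.galoisLevelData h36).piPresentation h36.isCountable T R).cosetGraphTrans
            ((𝒢.galoisLevelData h36).ker_piLevelAut_anti h36.isCountable hconn h)).branchMap (β i') = β i ∧
        (((𝒢.galoisLevelData h36).piPresentation h36.isCountable T R).cosetGraphTrans
            ((𝒢.galoisLevelData h36).ker_piLevelAut_anti h36.isCountable hconn h)).branchMap (β' i') = β' i) →
      (∀ (i : {i : ℕ // j₀ ≤ i}) (γ : C),
        (((𝒢.galoisLevelData h36).piPresentation h36.isCountable T R).arithAct hP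
            ((𝒢.galoisLevelData h36).piLevelAut h36.isCountable hconn i.1).ker (hN i.1) (ι γ)).hom.vertexMap
            (w i) = w i ∧
        (((𝒢.galoisLevelData h36).piPresentation h36.isCountable T R).arithAct hP
            ((𝒢.galoisLevelData h36).piLevelAut h36.isCountable hconn i.1).ker (hN i.1) (ι γ)).hom.branchMap
            (β i) = β i ∧
        (((𝒢.galoisLevelData h36).piPresentation h36.isCountable T R).arithAct hP
            ((𝒢.galoisLevelData h36).piLevelAut h36.isCountable hconn i.1).ker (hN i.1) (ι γ)).hom.branchMap
            (β' i) = β' i) → C = ⊥)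
    (j₀ : ℕ)
    (w : ∀ i : {i : ℕ // j₀ ≤ i},
      (((𝒢.galoisLevelData h36).piPresentation h36.isCountable T R).cosetGraph
        ((𝒢.galoisLevelData h36).piLevelAut h36.isCountable hconn i.1).ker).Vertex)
    (β β' : ∀ i : {i : ℕ // j₀ ≤ i},
      (((𝒢.galoisLevelData h36).piPresentation h36.isCountable T R).cosetGraph
        ((𝒢.galoisLevelData h36).piLevelAut h36.isCountable hconn i.1).ker).Branch)
    (hpair : ∀ i, β i ≠ β' i ∧
      (((𝒢.galoisLevelData h36).piPresentation h36.isCountable T R).cosetGraph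
        ((𝒢.galoisLevelData h36).piLevelAut h36.isCountable hconn i.1).ker).abuts (β i) = some (w i) ∧
      (((𝒢.galoisLevelData h36).piPresentation h36.isCountable T R).cosetGraph
        ((𝒢.galoisLevelData h36).piLevelAut h36.isCountable hconn i.1).ker).abuts (β' i) = some (w i))
    (hcompat : ∀ ⦃i i' : {i : ℕ // j₀ ≤ i}⦄ (h : i.1 ≤ i'.1),
      (((𝒢.galoisLevelData h36).piPresentation h36.isCountable T R).cosetGraphTrans
          ((𝒢.galoisLevelData h36).ker_piLevelAut_anti h36.isCountable hconn h)).vertexMap (w i') = w i ∧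
      (((𝒢.galoisLevelData h36).piPresentation h36.isCountable T R).cosetGraphTrans
          ((𝒢.galoisLevelData h36).ker_piLevelAut_anti h36.isCountable hconn h)).branchMap (β i') = β i ∧
      (((𝒢.galoisLevelData h36).piPresentation h36.isCountable T R).cosetGraphTrans
          ((𝒢.galoisLevelData h36).ker_piLevelAut_anti h36.isCountable hconn h)).branchMap (β' i') = β' i) :
    ∀ v ∈ (decompositionDataOfChart Rc ι).vertGp v₀,
      (∀ n : ℕ, ((𝒢.galoisLevelData h36).piPresentation h36.isCountable T R).arithAct hP
          ((𝒢.galoisLevelData h36).piLevelAut h36.isCountable hconn n).ker (hN n) v = 1) →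
      aug v = 1 → v = 1 := by
  intro v hv htriv hav
  -- Step 1: `v` is geometric: `v = ι g`
  have hvr : v ∈ ι.range := by rw [← haug]; exact (MonoidHom.mem_ker).mpr hav
  -- Step 2: `g` lies in the chosen verticial subgroup at `v₀` (commensurable terminality, Thm 3.7 (ii))
  have hct : Subgroup.Commensurable.commensurator (Rc.Hv v₀) = Rc.Hv v₀ :=
    commensurator_eq_of_mem_verticialSubgroups h37 (𝒢.temperedPiChart h36) (Rc.Hv_mem v₀)
  have hvmap : v ∈ (Rc.Hv v₀).map ι := by
    rw [← arithVertGp_inf_range_of_commTerminal Rc hι hct]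
    exact ⟨hv, hvr⟩
  obtain ⟨g, hgH, rfl⟩ := hvmap
  -- Step 3: the compact host and the closed level kernels
  let N : ℕ → Subgroup (𝒢.temperedPiChart h36).G := fun n =>
    ((((𝒢.galoisLevelData h36).piPresentation h36.isCountable T R).arithAct hP
      ((𝒢.galoisLevelData h36).piLevelAut h36.isCountable hconn n).ker (hN n)).comp ι).ker
  have hLN : ∀ n, ((𝒢.galoisLevelData h36).piLevelAut h36.isCountable hconn n).ker ≤ N n := by
    intro n x hx
    exact (MonoidHom.mem_ker).mpr
      (((𝒢.galoisLevelData h36).piPresentation h36.isCountable T R).arithAct_eq_one_of_inner_mem hP _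
        (hN n) (hιΦ x) (hισ x) hx)
  have hNc : ∀ n, IsClosed ((N n : Subgroup (𝒢.temperedPiChart h36).G) : Set (𝒢.temperedPiChart h36).G) :=
    fun n => Subgroup.isClosed_of_open_le
      ((𝒢.galoisLevelData h36).isOpen_ker_piLevelAut h36.isCountable hconn n) (hLN n)
  -- Step 4: the compact-form killing hypothesis on kernels, from `hnobpNCpt` and the given system
  have hkill : ∀ C : Subgroup (𝒢.temperedPiChart h36).G,
      IsCompact (C : Set (𝒢.temperedPiChart h36).G) → (∀ n, C ≤ N n) → C = ⊥ := by
    intro C hC hCN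
    refine hnobpNCpt C hC j₀ w β β' hpair hcompat fun i γ => ?_
    have h1 : ((𝒢.galoisLevelData h36).piPresentation h36.isCountable T R).arithAct hP
        ((𝒢.galoisLevelData h36).piLevelAut h36.isCountable hconn i.1).ker (hN i.1) (ι γ) = 1 :=
      (MonoidHom.mem_ker).mp (hCN i.1 γ.2)
    have h2 : (((𝒢.galoisLevelData h36).piPresentation h36.isCountable T R).arithAct hP
        ((𝒢.galoisLevelData h36).piLevelAut h36.isCountable hconn i.1).ker (hN i.1) (ι γ)).hom = 𝟙 _ := by
      rw [h1]; rfl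
    simp only [h2, SemiGraph.id_vertexMap, SemiGraph.id_branchMap, id_eq, and_self]
  -- Step 5: conclude
  have hg1 : g = 1 :=
    eq_one_of_mem_compact_of_forall_mem_closed
      (isCompact_of_mem_verticialSubgroups (𝒢.temperedPiChart h36) (Rc.Hv_mem v₀)) N hNc hkill hgH
      (fun n => (MonoidHom.mem_ker).mpr (htriv n))
  rw [hg1, map_one]

/-! ### At the outer model `π₁^temp(𝒢) ⋊^out Π_A` of the T54-B capstone -/

/-- **Row «T54·hfaith-geom» AT THE OUTER MODEL** `E := π₁^temp(𝒢) ⋊^out Π_A` of abc-iut-w4-d029's capstone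
`arithMaximalCompactStatementI_outerAction_piPresentation` (`ι := toOuterSemidirectProduct ρ'`,
`aug := outerSemidirectProductSnd ρ'`, `Φ`/`σ` the capstone's): exactness `ker aug = range ι` and
injectivity of `ι` are abc-iut-L3-d2's `outerAction_exact` (temp-slimness, Prop. 3.6 (iv)), `Φ (ι g) = conj g`
holds by `rfl` and `σ (ι g) = 1` by exactness — so the binder `hfaith` of the (AI4″) producer holds at the
outer model from `hnobpNCpt` and one compatible branch-pair system. [cite: MochizukiSemiAnbd2006, Thm 5.4 (i) p.66] -/
theorem hfaith_geom_outerAction (h36 : 𝒢.Prop36Hypotheses) (h37 : 𝒢.Thm37Hypotheses)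
    (hconn : ∀ (n : ℕ) (p q : ((𝒢.galoisLevelData h36).S n).Point),
      ((𝒢.galoisLevelData h36).S n).SameComponent p q)
    (T : ∀ w : 𝒢.graph.Vertex, (𝒢.galoisLevelData h36).PointSeq h36.isCountable w)
    (R : SemiGraph.RefBranches 𝒢.graph) {PA : Type w} [Group PA]
    (ρ' : PA →* TopOut (𝒢.temperedPiChart h36).G) (baseAct : PA →* Aut 𝒢.graph)
    (hP : ((𝒢.galoisLevelData h36).piPresentation h36.isCountable T R).IsArithCompatible
      (((contMulAut (𝒢.temperedPiChart h36).G).subtype.comp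
        (MonoidHom.fst (contMulAut (𝒢.temperedPiChart h36).G) PA)).comp (outerSemidirectProduct ρ').subtype)
      (baseAct.comp (outerSemidirectProductSnd ρ')))
    (hN : ∀ (n : ℕ) (e : outerSemidirectProduct ρ') (x : (𝒢.temperedPiChart h36).G),
      x ∈ ((𝒢.galoisLevelData h36).piLevelAut h36.isCountable hconn n).ker →
        (((contMulAut (𝒢.temperedPiChart h36).G).subtype.comp
          (MonoidHom.fst (contMulAut (𝒢.temperedPiChart h36).G) PA)).comp (outerSemidirectProduct ρ').subtype)
          e x ∈ ((𝒢.galoisLevelData h36).piLevelAut h36.isCountable hconn n).ker)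
    (Rc : ChartRepresentatives (𝒢.temperedPiChart h36)) (v₀ : 𝒢.graph.Vertex)
    (hnobpNCpt : ∀ (C : Subgroup (𝒢.temperedPiChart h36).G),
      IsCompact (C : Set (𝒢.temperedPiChart h36).G) →
      ∀ (j₀ : ℕ) (w : ∀ i : {i : ℕ // j₀ ≤ i},
        (((𝒢.galoisLevelData h36).piPresentation h36.isCountable T R).cosetGraph
          ((𝒢.galoisLevelData h36).piLevelAut h36.isCountable hconn i.1).ker).Vertex)
      (β β' : ∀ i : {i : ℕ // j₀ ≤ i},
        (((𝒢.galoisLevelData h36).piPresentation h36.isCountable T R).cosetGraph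
          ((𝒢.galoisLevelData h36).piLevelAut h36.isCountable hconn i.1).ker).Branch),
      (∀ i, β i ≠ β' i ∧
        (((𝒢.galoisLevelData h36).piPresentation h36.isCountable T R).cosetGraph
          ((𝒢.galoisLevelData h36).piLevelAut h36.isCountable hconn i.1).ker).abuts (β i) = some (w i) ∧
        (((𝒢.galoisLevelData h36).piPresentation h36.isCountable T R).cosetGraph
          ((𝒢.galoisLevelData h36).piLevelAut h36.isCountable hconn i.1).ker).abuts (β' i) = some (w i)) →
      (∀ ⦃i i' : {i : ℕ // j₀ ≤ i}⦄ (h : i.1 ≤ i'.1),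
        (((𝒢.galoisLevelData h36).piPresentation h36.isCountable T R).cosetGraphTrans
            ((𝒢.galoisLevelData h36).ker_piLevelAut_anti h36.isCountable hconn h)).vertexMap (w i') = w i ∧
        (((𝒢.galoisLevelData h36).piPresentation h36.isCountable T R).cosetGraphTrans
            ((𝒢.galoisLevelData h36).ker_piLevelAut_anti h36.isCountable hconn h)).branchMap (β i') = β i ∧
        (((𝒢.galoisLevelData h36).piPresentation h36.isCountable T R).cosetGraphTrans
            ((𝒢.galoisLevelData h36).ker_piLevelAut_anti h36.isCountable hconn h)).branchMap (β' i') = β' i) →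
      (∀ (i : {i : ℕ // j₀ ≤ i}) (γ : C),
        (((𝒢.galoisLevelData h36).piPresentation h36.isCountable T R).arithAct hP
            ((𝒢.galoisLevelData h36).piLevelAut h36.isCountable hconn i.1).ker (hN i.1)
            ((toOuterSemidirectProduct ρ') γ)).hom.vertexMap (w i) = w i ∧
        (((𝒢.galoisLevelData h36).piPresentation h36.isCountable T R).arithAct hP
            ((𝒢.galoisLevelData h36).piLevelAut h36.isCountable hconn i.1).ker (hN i.1)
            ((toOuterSemidirectProduct ρ') γ)).hom.branchMap (β i) = β i ∧
        (((𝒢.galoisLevelData h36).piPresentation h36.isCountable T R).arithAct hP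
            ((𝒢.galoisLevelData h36).piLevelAut h36.isCountable hconn i.1).ker (hN i.1)
            ((toOuterSemidirectProduct ρ') γ)).hom.branchMap (β' i) = β' i) → C = ⊥)
    (j₀ : ℕ)
    (w : ∀ i : {i : ℕ // j₀ ≤ i},
      (((𝒢.galoisLevelData h36).piPresentation h36.isCountable T R).cosetGraph
        ((𝒢.galoisLevelData h36).piLevelAut h36.isCountable hconn i.1).ker).Vertex)
    (β β' : ∀ i : {i : ℕ // j₀ ≤ i},
      (((𝒢.galoisLevelData h36).piPresentation h36.isCountable T R).cosetGraph
        ((𝒢.galoisLevelData h36).piLevelAut h36.isCountable hconn i.1).ker).Branch)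
    (hpair : ∀ i, β i ≠ β' i ∧
      (((𝒢.galoisLevelData h36).piPresentation h36.isCountable T R).cosetGraph
        ((𝒢.galoisLevelData h36).piLevelAut h36.isCountable hconn i.1).ker).abuts (β i) = some (w i) ∧
      (((𝒢.galoisLevelData h36).piPresentation h36.isCountable T R).cosetGraph
        ((𝒢.galoisLevelData h36).piLevelAut h36.isCountable hconn i.1).ker).abuts (β' i) = some (w i))
    (hcompat : ∀ ⦃i i' : {i : ℕ // j₀ ≤ i}⦄ (h : i.1 ≤ i'.1),
      (((𝒢.galoisLevelData h36).piPresentation h36.isCountable T R).cosetGraphTrans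
          ((𝒢.galoisLevelData h36).ker_piLevelAut_anti h36.isCountable hconn h)).vertexMap (w i') = w i ∧
      (((𝒢.galoisLevelData h36).piPresentation h36.isCountable T R).cosetGraphTrans
          ((𝒢.galoisLevelData h36).ker_piLevelAut_anti h36.isCountable hconn h)).branchMap (β i') = β i ∧
      (((𝒢.galoisLevelData h36).piPresentation h36.isCountable T R).cosetGraphTrans
          ((𝒢.galoisLevelData h36).ker_piLevelAut_anti h36.isCountable hconn h)).branchMap (β' i') = β' i) :
    ∀ v ∈ (decompositionDataOfChart Rc (toOuterSemidirectProduct ρ')).vertGp v₀,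
      (∀ n : ℕ, ((𝒢.galoisLevelData h36).piPresentation h36.isCountable T R).arithAct hP
          ((𝒢.galoisLevelData h36).piLevelAut h36.isCountable hconn n).ker (hN n) v = 1) →
      outerSemidirectProductSnd ρ' v = 1 → v = 1 := by
  -- exactness of `1 → π₁^temp → E → Π_A → 1` (temp-slimness), abc-iut-L3-d2
  obtain ⟨hι, hex, -⟩ := outerAction_exact (𝒢.temperedPiChart h36) ρ' h36
  have hισ : ∀ g : (𝒢.temperedPiChart h36).G,
      (baseAct.comp (outerSemidirectProductSnd ρ')) ((toOuterSemidirectProduct ρ') g) = 1 := fun g => by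
    have hg : (toOuterSemidirectProduct ρ') g ∈ (outerSemidirectProductSnd ρ').ker := hex ▸ ⟨g, rfl⟩
    rw [MonoidHom.comp_apply, (MonoidHom.mem_ker).mp hg, map_one]
  exact hfaith_geom_cosetTower h36 h37 hconn T R hP hN (toOuterSemidirectProduct ρ') hι (fun _ => rfl) hισ
    (outerSemidirectProductSnd ρ') hex.symm Rc v₀ hnobpNCpt j₀ w β β' hpair hcompat

/-! ### v2 (append-only): `hnobpNCpt` DISCHARGED inside — (I4′)_cpt via (I0v), a theorem (`galoisLevelData_faithfulV`) -/

/-- **Row «T54·hfaith-geom», UNCONDITIONAL FORM at the canonical coset tower**: `hnobpNCpt` supplied by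
abc-iut-w4-d083's `hnobpNCpt_cosetTower_of_faithV` (p431207) fed with abc-iut-L3-t8's THEOREM
`galoisLevelData_faithfulV` (p419083, (I0v) from Thm 3.7 (i) `verticialInjective_holds`): the (AI4″) binder `hfaith`
from (`h36`, `h37`, ONE compatible coset branch-pair system) alone — no residual binder.
[cite: MochizukiSemiAnbd2006, Thm 5.4 (i) p.66] -/
theorem hfaith_geom_cosetTower_of_tower (h36 : 𝒢.Prop36Hypotheses) (h37 : 𝒢.Thm37Hypotheses)
    (hconn : ∀ (n : ℕ) (p q : ((𝒢.galoisLevelData h36).S n).Point),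
      ((𝒢.galoisLevelData h36).S n).SameComponent p q)
    (T : ∀ w : 𝒢.graph.Vertex, (𝒢.galoisLevelData h36).PointSeq h36.isCountable w)
    (R : SemiGraph.RefBranches 𝒢.graph) {E : Type v} [Group E]
    {Φ : E →* MulAut (𝒢.temperedPiChart h36).G} {σ : E →* Aut 𝒢.graph}
    (hP : ((𝒢.galoisLevelData h36).piPresentation h36.isCountable T R).IsArithCompatible Φ σ)
    (hN : ∀ (n : ℕ) (e : E) (x : (𝒢.temperedPiChart h36).G),
      x ∈ ((𝒢.galoisLevelData h36).piLevelAut h36.isCountable hconn n).ker →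
        Φ e x ∈ ((𝒢.galoisLevelData h36).piLevelAut h36.isCountable hconn n).ker)
    (ι : (𝒢.temperedPiChart h36).G →* E) (hι : Function.Injective ι)
    (hιΦ : ∀ g, Φ (ι g) = MulAut.conj g) (hισ : ∀ g, σ (ι g) = 1)
    {PA : Type w} [Group PA] (aug : E →* PA) (haug : aug.ker = ι.range)
    (Rc : ChartRepresentatives (𝒢.temperedPiChart h36)) (v₀ : 𝒢.graph.Vertex)
    (j₀ : ℕ) (w : ∀ i : {i : ℕ // j₀ ≤ i}, (((𝒢.galoisLevelData h36).piPresentation h36.isCountable T R).cosetGraph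
        ((𝒢.galoisLevelData h36).piLevelAut h36.isCountable hconn i.1).ker).Vertex)
    (β β' : ∀ i : {i : ℕ // j₀ ≤ i}, (((𝒢.galoisLevelData h36).piPresentation h36.isCountable T R).cosetGraph
        ((𝒢.galoisLevelData h36).piLevelAut h36.isCountable hconn i.1).ker).Branch)
    (hpair : ∀ i, β i ≠ β' i ∧ (((𝒢.galoisLevelData h36).piPresentation h36.isCountable T R).cosetGraph
        ((𝒢.galoisLevelData h36).piLevelAut h36.isCountable hconn i.1).ker).abuts (β i) = some (w i) ∧
      (((𝒢.galoisLevelData h36).piPresentation h36.isCountable T R).cosetGraph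
        ((𝒢.galoisLevelData h36).piLevelAut h36.isCountable hconn i.1).ker).abuts (β' i) = some (w i))
    (hcompat : ∀ ⦃i i' : {i : ℕ // j₀ ≤ i}⦄ (h : i.1 ≤ i'.1),
      (((𝒢.galoisLevelData h36).piPresentation h36.isCountable T R).cosetGraphTrans
          ((𝒢.galoisLevelData h36).ker_piLevelAut_anti h36.isCountable hconn h)).vertexMap (w i') = w i ∧
      (((𝒢.galoisLevelData h36).piPresentation h36.isCountable T R).cosetGraphTrans
          ((𝒢.galoisLevelData h36).ker_piLevelAut_anti h36.isCountable hconn h)).branchMap (β i') = β i ∧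
      (((𝒢.galoisLevelData h36).piPresentation h36.isCountable T R).cosetGraphTrans
          ((𝒢.galoisLevelData h36).ker_piLevelAut_anti h36.isCountable hconn h)).branchMap (β' i') = β' i) :
    ∀ v ∈ (decompositionDataOfChart Rc ι).vertGp v₀,
      (∀ n : ℕ, ((𝒢.galoisLevelData h36).piPresentation h36.isCountable T R).arithAct hP
          ((𝒢.galoisLevelData h36).piLevelAut h36.isCountable hconn n).ker (hN n) v = 1) →
      aug v = 1 → v = 1 :=
  hfaith_geom_cosetTower h36 h37 hconn T R hP hN ι hι hιΦ hισ aug haug Rc v₀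
    (hnobpNCpt_cosetTower_of_faithV h36 h37 hconn T R hP hN ι hιΦ hισ
      fun v h hfix => 𝒢.galoisLevelData_faithfulV h37 v h hfix)
    j₀ w β β' hpair hcompat

/-- **Row «T54·hfaith-geom», UNCONDITIONAL FORM at the OUTER MODEL** `π₁^temp(𝒢) ⋊^out Π_A` of the T54-B
capstone: `hfaith_geom_outerAction` with `hnobpNCpt` discharged as above. [cite: MochizukiSemiAnbd2006, Thm 5.4 (i) p.66] -/
theorem hfaith_geom_outerAction_of_tower (h36 : 𝒢.Prop36Hypotheses) (h37 : 𝒢.Thm37Hypotheses)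
    (hconn : ∀ (n : ℕ) (p q : ((𝒢.galoisLevelData h36).S n).Point),
      ((𝒢.galoisLevelData h36).S n).SameComponent p q)
    (T : ∀ w : 𝒢.graph.Vertex, (𝒢.galoisLevelData h36).PointSeq h36.isCountable w)
    (R : SemiGraph.RefBranches 𝒢.graph) {PA : Type w} [Group PA]
    (ρ' : PA →* TopOut (𝒢.temperedPiChart h36).G) (baseAct : PA →* Aut 𝒢.graph)
    (hP : ((𝒢.galoisLevelData h36).piPresentation h36.isCountable T R).IsArithCompatible
      (((contMulAut (𝒢.temperedPiChart h36).G).subtype.comp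
        (MonoidHom.fst (contMulAut (𝒢.temperedPiChart h36).G) PA)).comp (outerSemidirectProduct ρ').subtype)
      (baseAct.comp (outerSemidirectProductSnd ρ')))
    (hN : ∀ (n : ℕ) (e : outerSemidirectProduct ρ') (x : (𝒢.temperedPiChart h36).G),
      x ∈ ((𝒢.galoisLevelData h36).piLevelAut h36.isCountable hconn n).ker →
        (((contMulAut (𝒢.temperedPiChart h36).G).subtype.comp
          (MonoidHom.fst (contMulAut (𝒢.temperedPiChart h36).G) PA)).comp (outerSemidirectProduct ρ').subtype)
          e x ∈ ((𝒢.galoisLevelData h36).piLevelAut h36.isCountable hconn n).ker)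
    (Rc : ChartRepresentatives (𝒢.temperedPiChart h36)) (v₀ : 𝒢.graph.Vertex)
    (j₀ : ℕ) (w : ∀ i : {i : ℕ // j₀ ≤ i}, (((𝒢.galoisLevelData h36).piPresentation h36.isCountable T R).cosetGraph
        ((𝒢.galoisLevelData h36).piLevelAut h36.isCountable hconn i.1).ker).Vertex)
    (β β' : ∀ i : {i : ℕ // j₀ ≤ i}, (((𝒢.galoisLevelData h36).piPresentation h36.isCountable T R).cosetGraph
        ((𝒢.galoisLevelData h36).piLevelAut h36.isCountable hconn i.1).ker).Branch)
    (hpair : ∀ i, β i ≠ β' i ∧ (((𝒢.galoisLevelData h36).piPresentation h36.isCountable T R).cosetGraph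
        ((𝒢.galoisLevelData h36).piLevelAut h36.isCountable hconn i.1).ker).abuts (β i) = some (w i) ∧
      (((𝒢.galoisLevelData h36).piPresentation h36.isCountable T R).cosetGraph
        ((𝒢.galoisLevelData h36).piLevelAut h36.isCountable hconn i.1).ker).abuts (β' i) = some (w i))
    (hcompat : ∀ ⦃i i' : {i : ℕ // j₀ ≤ i}⦄ (h : i.1 ≤ i'.1),
      (((𝒢.galoisLevelData h36).piPresentation h36.isCountable T R).cosetGraphTrans
          ((𝒢.galoisLevelData h36).ker_piLevelAut_anti h36.isCountable hconn h)).vertexMap (w i') = w i ∧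
      (((𝒢.galoisLevelData h36).piPresentation h36.isCountable T R).cosetGraphTrans
          ((𝒢.galoisLevelData h36).ker_piLevelAut_anti h36.isCountable hconn h)).branchMap (β i') = β i ∧
      (((𝒢.galoisLevelData h36).piPresentation h36.isCountable T R).cosetGraphTrans
          ((𝒢.galoisLevelData h36).ker_piLevelAut_anti h36.isCountable hconn h)).branchMap (β' i') = β' i) :
    ∀ v ∈ (decompositionDataOfChart Rc (toOuterSemidirectProduct ρ')).vertGp v₀,
      (∀ n : ℕ, ((𝒢.galoisLevelData h36).piPresentation h36.isCountable T R).arithAct hP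
          ((𝒢.galoisLevelData h36).piLevelAut h36.isCountable hconn n).ker (hN n) v = 1) →
      outerSemidirectProductSnd ρ' v = 1 → v = 1 := by
  obtain ⟨hι, hex, -⟩ := outerAction_exact (𝒢.temperedPiChart h36) ρ' h36
  have hισ : ∀ g : (𝒢.temperedPiChart h36).G,
      (baseAct.comp (outerSemidirectProductSnd ρ')) ((toOuterSemidirectProduct ρ') g) = 1 := fun g => by
    have hg : (toOuterSemidirectProduct ρ') g ∈ (outerSemidirectProductSnd ρ').ker := hex ▸ ⟨g, rfl⟩
    rw [MonoidHom.comp_apply, (MonoidHom.mem_ker).mp hg, map_one]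
  exact hfaith_geom_cosetTower_of_tower h36 h37 hconn T R hP hN (toOuterSemidirectProduct ρ') hι (fun _ => rfl)
    hισ (outerSemidirectProductSnd ρ') hex.symm Rc v₀ j₀ w β β' hpair hcompat

end ProfiniteSemiGraph

end Literature.AnabelianGeometry.SemiGraphs
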